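import Summits.QuantumFields.YangMills.Theorems.UnitScaleTiltProp7ResolventSmoothing
import Summits.QuantumFields.YangMills.Theorems.UnitScaleTiltProp7RightInverseOfApprox
import HarnessLib

/-!
# Route `UnitScaleTilt`, crux K1 child «MinimiserStabilityRegPr» (stmt-QuantumFields-19200), skeleton v10, stub `stub_existenceMinimalOrbit` (EX), route (α) —
# **R2q″ FILE 3 «R2q″-ASSEMBLY»: THE EXACT `H²`-SMOOTH RIGHT INVERSE ROW (Q4-H²) OF ✓`Prop7LandauTransversalityPairing.hS_of_rowsZ` ∕ ✓`htest_of_rows` FROM AN `H¹` PREIMAGE MAP,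
# AN APPROXIMATE-IDENTITY ROW, A BOUNDEDNESS ROW AND RESOLVENT SMOOTHING** ((P2-core) plan v2, design word of record STATUS 19:56:45Z ∕ 19:59Z: preimage `S` = corner-axial framed fat
# bump (★px10 g2 FILE 2) with rows `‖toL2S (S c)‖ ≤ s₀·q c`, `‖D_{U₀}(toL2S (S c))‖ ≤ s₁·q c`; approximate identity `q(𝓚(S c) − κ•c) ≤ θ₀κ·q c` ((d1) ★px6 g2 R2t + (d2) ★px20 g2
# nested mean vs reference mean); boundedness `q(𝓚 g) ≤ C_𝓚‖toL2S g‖` (★px6 g2); smoothing `R = (1 + tΔ^η_{U₀})⁻¹` (✓`Prop7ResolventSmoothing.exists_smoothing_linear`); solve door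
# ✓`Prop7RightInverseOfApprox.exists_rightInverse_of_approx_gauge` (★px10 g2) applied to the LINEAR map `𝓚 ∘ R ∘ S`).

Cell `ym3-torus`, width seat `ym-ust-20520-w5` (gen 7).  THEOREMS ONLY (0 `def`, 0 `sorry`).  `--supports stmt-QuantumFields-19200 --as helper`, count-neutral.  YM₃ on T³ is a
ladder rung (R3), not the Clay problem; nothing here claims the stub, the crux, d = 4 or the mass gap.

WHAT IS PROVED (sorry-free, no definition; ns `…Theorems.Prop7ResolventSmoothing`):
* `gauge_nonneg` — a gauge `q` with `q(a + b) ≤ q a + q b`, `q(r•a) = |r|·q a` is non-negative.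
* ★★`happrox_smoothing` — the approximate-identity row transfers from `S` to `R ∘ S`: `q(𝓚(R(S c)) − κ•c) ≤ (θ₀ + C_𝓚·√(t∕2)·s₁∕κ)·κ·q c`.
* ★★★`hQ4_of_rows` — (Q4-H²) VERBATIM in ✓`hS_of_rowsZ`'s shape: `∀ m, ∃ N, 𝓚 N = m ∧ ‖toL2S N‖ ≤ C₀·q m ∧ ‖D_{U₀}(toL2S N)‖ ≤ C₀·q m ∧ ‖Δ^η_{U₀}(toL2S N)‖ ≤ C₀·q m` with the LETTER constant
  `C₀ := (s₀ + s₁ + s₁∕√(2t)) ∕ (κ·(1 − θ))`, `θ := θ₀ + C_𝓚·√(t∕2)·s₁∕κ < 1`, for ANY finite-dimensional coarse module `Y`, linear `𝓚`, linear `S`, gauge `q`.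
HONEST SCOPE.  Assembly of displayed rows; the rows' suppliers are the named plan-v2 files; nothing of print asserted; no stub ∕ crux statement advanced.

References: T. Bałaban, CMP 99 (1985) 389–434 [Balaban1985BackgroundPropagators] ((3.8) p.392, (3.23) p.394, (3.115) p.418); CMP 102 (1985) 277–309 [Balaban1985Variational]
((45) p.285, (82)–(83) p.290); CMP 98 (1985) 17–51 [Balaban1985Averaging] ((97) p.32).
-/

set_option autoImplicit false

noncomputable section

open scoped InnerProductSpace Matrix.Norms.L2Operator ComplexConjugate

namespace Summit.QuantumFields.YangMills.Theorems.Prop7ResolventSmoothing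

open Literature.MathematicalPhysics.QuantumFieldTheory.Balaban1983to89
open Literature.MathematicalPhysics.QuantumFieldTheory.Balaban1983to89.T3ContinuumYM3Torus
open Literature.MathematicalPhysics.QuantumFieldTheory.Balaban1983to89.T3SectALandauChart (eta eta_pos)
open B11Eq103H1Complex (SiteL2K BondL2K)
open Summit.QuantumFields.YangMills.Theorems.Prop7SectET3Transport (periodsT3)
open Summit.QuantumFields.YangMills.Theorems.Prop7SectET3HilbertLetters (W₂ toL2 toL2S DL2 DstarL2 covLapSite adjoint_DL2)
open Summit.QuantumFields.YangMills.Theorems.Prop7RightInverseOfApprox (exists_rightInverse_of_approx_gauge)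

variable (F : T3Family) {n K : ℕ} {c₀ : ℝ} [Fact (0 < c₀)]

/-- **A GAUGE IS NON-NEGATIVE**: `q(a + b) ≤ q a + q b` and `q((r:ℂ)•a) = |r|·q a` give `0 ≤ q a` (`q 0 = 0`, `q(−a) = q a`). [folklore] -/
theorem gauge_nonneg {Y : Type*} [AddCommGroup Y] [Module ℂ Y] (q : Y → ℝ) (hq_add : ∀ a b, q (a + b) ≤ q a + q b)
    (hq_smul : ∀ (r : ℝ) (a : Y), q (((r : ℝ) : ℂ) • a) = |r| * q a) (a : Y) : 0 ≤ q a := by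
  have hq_neg : q (-a) = q a := by
    have h := hq_smul (-1) a
    rwa [show (((-1 : ℝ) : ℝ) : ℂ) • a = -a by push_cast; rw [neg_one_smul], abs_neg, abs_one, one_mul] at h
  have hq_zero : q 0 = 0 := by
    have h := hq_smul 0 (0 : Y)
    rwa [smul_zero, abs_zero, zero_mul] at h
  have h := hq_add a (-a)
  rw [add_neg_cancel, hq_zero, hq_neg] at h
  linarith

/-- ★★ **THE APPROXIMATE-IDENTITY ROW SURVIVES SMOOTHING.**  If `q(𝓚(S c) − κ•c) ≤ θ₀κ·q c`, `q(𝓚 g) ≤ C_𝓚·‖toL2S g‖`, `‖D_{U₀}(toL2S (S c))‖ ≤ s₁·q c` and `R` displaces by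
`‖toL2S (R f) − toL2S f‖ ≤ √(t∕2)·‖D_{U₀}(toL2S f)‖`, then `q(𝓚(R(S c)) − κ•c) ≤ (θ₀ + C_𝓚·√(t∕2)·s₁∕κ)·κ·q c`.
[cite: Balaban1985BackgroundPropagators, (3.23) p.394, (3.115) p.418] -/
theorem happrox_smoothing (U₀ : GaugeField (F.P K) 0 (Matrix.specialUnitaryGroup (Fin 2) ℂ)) {Y : Type*} [AddCommGroup Y] [Module ℂ Y]
    (Kop : (Site (F.P K) 0 → Matrix (Fin 2) (Fin 2) ℂ) →ₗ[ℂ] Y) (S : Y →ₗ[ℂ] (Site (F.P K) 0 → Matrix (Fin 2) (Fin 2) ℂ))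
    (R : (Site (F.P K) 0 → Matrix (Fin 2) (Fin 2) ℂ) →ₗ[ℂ] (Site (F.P K) 0 → Matrix (Fin 2) (Fin 2) ℂ)) (q : Y → ℝ)
    (hq_add : ∀ a b, q (a + b) ≤ q a + q b) {κ θ₀ s₁ CK t : ℝ} (hκ : 0 < κ) (hCK : 0 ≤ CK)
    (hS1 : ∀ c, ‖DL2 F n K c₀ U₀ (toL2S F K c₀ (S c))‖ ≤ s₁ * q c) (hK : ∀ g, q (Kop g) ≤ CK * ‖toL2S F K c₀ g‖)
    (hR : ∀ f, ‖toL2S F K c₀ (R f) - toL2S F K c₀ f‖ ≤ Real.sqrt (t / 2) * ‖DL2 F n K c₀ U₀ (toL2S F K c₀ f)‖)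
    (happrox : ∀ c, q (Kop (S c) - ((κ : ℝ) : ℂ) • c) ≤ θ₀ * κ * q c) :
    ∀ c, q (Kop ((R ∘ₗ S) c) - ((κ : ℝ) : ℂ) • c) ≤ (θ₀ + CK * (Real.sqrt (t / 2) * s₁) / κ) * κ * q c := by
  intro c
  have hsplit : Kop (R (S c)) - ((κ : ℝ) : ℂ) • c = (Kop (S c) - ((κ : ℝ) : ℂ) • c) + Kop (R (S c) - S c) := by rw [map_sub]; abel
  calc q (Kop ((R ∘ₗ S) c) - ((κ : ℝ) : ℂ) • c) = q ((Kop (S c) - ((κ : ℝ) : ℂ) • c) + Kop (R (S c) - S c)) := by rw [LinearMap.comp_apply, hsplit]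
    _ ≤ q (Kop (S c) - ((κ : ℝ) : ℂ) • c) + q (Kop (R (S c) - S c)) := hq_add _ _
    _ ≤ θ₀ * κ * q c + CK * ‖toL2S F K c₀ (R (S c) - S c)‖ := add_le_add (happrox c) (hK _)
    _ ≤ θ₀ * κ * q c + CK * (Real.sqrt (t / 2) * (s₁ * q c)) := by
          refine add_le_add le_rfl (mul_le_mul_of_nonneg_left ?_ hCK)
          rw [map_sub]
          exact (hR (S c)).trans (mul_le_mul_of_nonneg_left (hS1 c) (Real.sqrt_nonneg _))
    _ = (θ₀ + CK * (Real.sqrt (t / 2) * s₁) / κ) * κ * q c := by rw [add_mul, div_mul_cancel₀ _ hκ.ne']; ring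

/-- ★★★ **(Q4-H²) FROM THE R2q″ ROWS.**  Data: a finite-dimensional coarse ℂ-module `Y` with a gauge `q`, a LINEAR frame-corrected gauge operator `𝓚 : (Site → M₂) →ₗ Y`, a LINEAR preimage map
`S : Y →ₗ (Site → M₂)`.  ROWS: (H⁰) `‖toL2S (S c)‖ ≤ s₀·q c`; (H¹) `‖D_{U₀}(toL2S (S c))‖ ≤ s₁·q c`; boundedness `q(𝓚 g) ≤ C_𝓚·‖toL2S g‖`; approximate identity `q(𝓚(S c) − κ•c) ≤ θ₀κ·q c`;
`t > 0` with `θ := θ₀ + C_𝓚·√(t∕2)·s₁∕κ < 1`.  THEN, with `R := (1 + tΔ^η_{U₀})⁻¹` (✓`exists_smoothing_linear`) and the solve door ✓`exists_rightInverse_of_approx_gauge` on `𝓚 ∘ (R ∘ S)`: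
`∀ m, ∃ N, 𝓚 N = m ∧ ‖toL2S N‖ ≤ C₀·q m ∧ ‖D_{U₀}(toL2S N)‖ ≤ C₀·q m ∧ ‖Δ^η_{U₀}(toL2S N)‖ ≤ C₀·q m`, `C₀ := (s₀ + s₁ + s₁∕√(2t))∕(κ(1 − θ))` — the (Q4-H²) row of ✓`hS_of_rowsZ` ∕
✓`htest_of_rows` VERBATIM. [cite: Balaban1985BackgroundPropagators, (3.8) p.392, (3.23) p.394, (3.115) p.418; Balaban1985Variational, (45) p.285, (82)–(83) p.290; Balaban1985Averaging, (97) p.32] -/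
theorem hQ4_of_rows (U₀ : GaugeField (F.P K) 0 (Matrix.specialUnitaryGroup (Fin 2) ℂ)) {Y : Type*} [AddCommGroup Y] [Module ℂ Y] [FiniteDimensional ℂ Y]
    (Kop : (Site (F.P K) 0 → Matrix (Fin 2) (Fin 2) ℂ) →ₗ[ℂ] Y) (S : Y →ₗ[ℂ] (Site (F.P K) 0 → Matrix (Fin 2) (Fin 2) ℂ)) (q : Y → ℝ)
    (hq_add : ∀ a b, q (a + b) ≤ q a + q b) (hq_smul : ∀ (r : ℝ) (a : Y), q (((r : ℝ) : ℂ) • a) = |r| * q a) (hq_def : ∀ a, q a = 0 → a = 0)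
    {κ θ₀ s₀ s₁ CK t : ℝ} (hκ : 0 < κ) (hs₀ : 0 ≤ s₀) (hs₁ : 0 ≤ s₁) (hCK : 0 ≤ CK) (ht : 0 < t)
    (hS0 : ∀ c, ‖toL2S F K c₀ (S c)‖ ≤ s₀ * q c) (hS1 : ∀ c, ‖DL2 F n K c₀ U₀ (toL2S F K c₀ (S c))‖ ≤ s₁ * q c)
    (hK : ∀ g, q (Kop g) ≤ CK * ‖toL2S F K c₀ g‖) (happrox : ∀ c, q (Kop (S c) - ((κ : ℝ) : ℂ) • c) ≤ θ₀ * κ * q c)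
    (hθ : θ₀ + CK * (Real.sqrt (t / 2) * s₁) / κ < 1) :
    ∀ m : Y, ∃ N : Site (F.P K) 0 → Matrix (Fin 2) (Fin 2) ℂ, Kop N = m ∧
      ‖toL2S F K c₀ N‖ ≤ (s₀ + s₁ + s₁ / Real.sqrt (2 * t)) / (κ * (1 - (θ₀ + CK * (Real.sqrt (t / 2) * s₁) / κ))) * q m ∧
      ‖DL2 F n K c₀ U₀ (toL2S F K c₀ N)‖ ≤ (s₀ + s₁ + s₁ / Real.sqrt (2 * t)) / (κ * (1 - (θ₀ + CK * (Real.sqrt (t / 2) * s₁) / κ))) * q m ∧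
      ‖covLapSite F n K c₀ U₀ (toL2S F K c₀ N)‖ ≤ (s₀ + s₁ + s₁ / Real.sqrt (2 * t)) / (κ * (1 - (θ₀ + CK * (Real.sqrt (t / 2) * s₁) / κ))) * q m := by
  obtain ⟨R, hR⟩ := exists_smoothing_linear F (n := n) (c₀ := c₀) U₀ ht
  set θ : ℝ := θ₀ + CK * (Real.sqrt (t / 2) * s₁) / κ with hθdef
  have happrox' := happrox_smoothing F U₀ Kop S R q hq_add hκ hCK hS1 hK (fun f => (hR f).2.2.2.2.1) happrox
  intro m
  obtain ⟨c, hc, hqc⟩ := exists_rightInverse_of_approx_gauge Kop (R ∘ₗ S) q hq_add hq_smul hq_def hκ hθ happrox' m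
  obtain ⟨-, h0, h1, h2, -, -⟩ := hR (S c)
  have hqm : 0 ≤ q m := gauge_nonneg q hq_add hq_smul m
  have h1θ : 0 < 1 - θ := by rw [hθdef]; linarith
  have h2t : 0 < Real.sqrt (2 * t) := Real.sqrt_pos.2 (by linarith)
  set X : ℝ := q m / (κ * (1 - θ)) with hX
  have hX0 : 0 ≤ X := div_nonneg hqm (mul_pos hκ h1θ).le
  have hcX : q c ≤ X := hqc
  have hsum : ∀ {s : ℝ}, 0 ≤ s → s ≤ s₀ + s₁ + s₁ / Real.sqrt (2 * t) → ∀ {v : ℝ}, v ≤ s * q c → v ≤ (s₀ + s₁ + s₁ / Real.sqrt (2 * t)) / (κ * (1 - θ)) * q m :=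
    fun {s} hs hs' {v} hv => by
      calc v ≤ s * q c := hv
        _ ≤ s * X := mul_le_mul_of_nonneg_left hcX hs
        _ ≤ (s₀ + s₁ + s₁ / Real.sqrt (2 * t)) * X := mul_le_mul_of_nonneg_right hs' hX0
        _ = (s₀ + s₁ + s₁ / Real.sqrt (2 * t)) / (κ * (1 - θ)) * q m := by rw [hX]; ring
  have hs₂ : 0 ≤ s₁ / Real.sqrt (2 * t) := div_nonneg hs₁ h2t.le
  refine ⟨R (S c), hc, ?_, ?_, ?_⟩
  · exact hsum hs₀ (by linarith) (h0.trans (hS0 c))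
  · exact hsum hs₁ (by linarith) (h1.trans (hS1 c))
  · refine hsum hs₂ (by linarith) ?_
    calc ‖covLapSite F n K c₀ U₀ (toL2S F K c₀ (R (S c)))‖ ≤ ‖DL2 F n K c₀ U₀ (toL2S F K c₀ (S c))‖ / Real.sqrt (2 * t) := h2
      _ ≤ s₁ * q c / Real.sqrt (2 * t) := div_le_div_of_nonneg_right (hS1 c) h2t.le
      _ = s₁ / Real.sqrt (2 * t) * q c := by ring

end Summit.QuantumFields.YangMills.Theorems.Prop7ResolventSmoothing

end
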